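import Literature.MathematicalPhysics.QuantumFieldTheory.Balaban1983to89.B10Eq47AxialChi
import HarnessLib

/-!
# THE TRANSVERSE VARIANCE OF STRAIGHT ROW TRANSPORTS COSTS ONE POWER OF THE ROW LENGTH: pair-averaged non-abelian Stokes on staircase ribbons
# (crux `FluctuationComparisonRegPrIntL`, stmt-QuantumFields-20520; registry v11.4 `Cruxes/FluctuationComparisonRegPrIntL/Lines/semiclassical_s2beta.lean` 3732b7df FROZEN, untouched)

Cell `ym3-torus` (YM ladder rung R3 = continuum `SU(2)` Yang–Mills on the three-torus — a RUNG: NOT d = 4, NOT infinite volume, NOT a mass gap, NOT Clay).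
Width seat `ym3-torus-px12` (gen 22); `--kind proof --supports stmt-QuantumFields-20520 --as helper`, count-neutral, DEFINITION-FREE (0 `def`, 0 `instance`,
0 `notation`, 0 `sorry`, default heartbeats).  Pure lattice kinematics for ANY gauge group `G` (`GaugeGroup`) on ANY torus `T^{(j)}` of the tree's `Params`.

WHY.  After ✓p811720 (6) `…S2BetaFlatInteriorDepthUniform` the depth-uniform flat growth letter `hFlat` (third hypothesis of ✓p811100 px16 g19 (D10)) is an INTER-block affair; the
inter-block bonds carry «through-face transporters» along straight rows of length `N = L^{K−J}` (HOME note `ym3-torus-px12/g22/HFLAT-ROAD-AFTER-6.px12g22.md`, px20 g18 UV3-NODE §53).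
The power of `N` that §53 (3) attributes to the Bianchi identity is harvested here ELEMENTARILY: the non-abelian Stokes INEQUALITY (lit ✓`B10Eq47AxialChi.dist1_rect_le`) holds on every
rectangle separately, so comparing two rows along the STAIRCASE ribbon between them and summing over all PAIRS of face points spreads the Cauchy–Schwarz weight over the whole slab:
mean square `≤ 2·N·(slab action in the two planes containing the row direction)` per pair — ONE power of `N` (comparing every row with ONE anchored row ∕ plane would cost `N·a`).

WHAT.  §1 `shiftN_comm`, `shiftN_add`, `rect_swap`, `dist1_rect_le_unoriented` (`μ ≠ ν`, plaquette terms written `dist1 (rect U y μ ν 1 1)`), ★`dist1_rect_sq_le` (Stokes in squares).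
§2 `dist1_rect_sq_le_strip`, ★★`sum_pair_dist1_rect_sq_le` (ONE transverse direction, all `a²` pairs of rows: `≤ N·a³·(strip sum)`).  §3 ★★`dist1_rowCompareFF_le` ∕ `dist1_rowCompareFB_le`
(the row comparison `T·Γ_far·T′⁻¹·Γ_near⁻¹` along the forward–forward ∕ forward–backward staircase is bounded by its two rectangle legs), the quadrant bookkeeping
`quadSum_le_of_plane_column(')`, ★★★`sum_quad_dist1_rowCompareFF_sq_le` ∕ `sum_quad_dist1_rowCompareFB_sq_le` (mean square over a quadrant of the `a × a` face `≤ 2·N·a⁴·(F_{μν} + F_{μρ})`).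

HONEST: kinematics (subadditivity and conjugation invariance of `dist1`, Cauchy–Schwarz, reindexing); NOT the variance letter for the box-gauge face data of (6) (whose in-block legs are
tree paths, not straight rows), NOT the mean part against the `m`-fold average, NOT hFlat; nothing of Bałaban's analysis; TUBE-REG∘, GAP♯∘, EXW∘, S2β, crux 20520 NOT proved; no registered
stub is closed; rung R3 = SU(2) YM₃ on T³ — NOT d = 4, NOT infinite volume, NOT a mass gap, NOT Clay; the Yang–Mills mass gap is NOT proved.  Sorry-free, axioms standard.

References: T. Bałaban, CMP **98** (1985) 17–51 [Balaban1985Averaging] ((9) p.19, (19) p.21); CMP **99** (1985) 75–102 [Balaban1985RegularSpaces] (Lemma 1 p.79);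
CMP **95** (1984) 17–40 [Balaban1984PropagatorsI] ((1.7) p.18); CMP **96** (1984) 223–250 [Balaban1984PropagatorsII] ((1.33)).
-/

set_option autoImplicit false

noncomputable section

namespace Summit.QuantumFields.YangMills.Theorems.FluctuationComparisonRegPrIntLS2BetaRowTransportVariance

open Finset
open Literature.MathematicalPhysics.QuantumFieldTheory.Balaban1983to89
open B10Eq47AxialChi (shiftN shiftN_zero shiftN_succ rowProd rowProd_zero rowProd_succ rect rect_one_one dist1_rect_le)

variable {P : Params} {j : ℕ} {G : Type*} [GaugeGroup G]

/-! ## §1 Torus bookkeeping and the orientation-free Stokes inequality in squares -/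

/-- Unit shifts in two directions commute on the torus. [folklore] -/
private theorem shift_comm (x : Site P j) (μ ν : Fin P.d) : (x.shift μ).shift ν = (x.shift ν).shift μ := by
  funext κ
  by_cases hκν : κ = ν
  · subst hκν
    by_cases hκμ : κ = μ
    · subst hκμ; rfl
    · simp [Site.shift, Function.update_apply, hκμ]
  · by_cases hκμ : κ = μ
    · subst hκμ; simp [Site.shift, Function.update_apply, hκν]
    · simp [Site.shift, Function.update_apply, hκμ, hκν]

/-- An `n`-fold shift commutes with a unit shift. [folklore] -/
private theorem shiftN_shift (x : Site P j) (μ ν : Fin P.d) :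
    ∀ n : ℕ, shiftN (x.shift ν) μ n = (shiftN x μ n).shift ν
  | 0 => rfl
  | n + 1 => by rw [shiftN_succ, shiftN_succ, shiftN_shift x μ ν n, shift_comm]

/-- Iterated shifts in two directions commute (`x + m e_ν + n e_μ = x + n e_μ + m e_ν`). [cite: Balaban1984PropagatorsI, (1.7) p.18] -/
theorem shiftN_comm (x : Site P j) (μ ν : Fin P.d) (n : ℕ) :
    ∀ m : ℕ, shiftN (shiftN x ν m) μ n = shiftN (shiftN x μ n) ν m
  | 0 => rfl
  | m + 1 => by rw [shiftN_succ, shiftN_succ, shiftN_shift, shiftN_comm x μ ν n m]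

/-- Iterated shifts in one direction add (`(x + m e_ν) + t e_ν = x + (m + t) e_ν`). [cite: Balaban1984PropagatorsI, (1.7) p.18] -/
theorem shiftN_add (x : Site P j) (ν : Fin P.d) (m : ℕ) : ∀ t : ℕ, shiftN (shiftN x ν m) ν t = shiftN x ν (m + t)
  | 0 => rfl
  | t + 1 => by rw [shiftN_succ, shiftN_add x ν m t, ← shiftN_succ, Nat.add_assoc]

/-- **Exchanging the two directions inverts the rectangle holonomy**: `U(∂R)` read as «`b e_ν` then `a e_μ`» is `(U(∂R)` read as «`a e_μ` then `b e_ν`»`)⁻¹`. [cite: Balaban1985Averaging, (9) p.19] -/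
theorem rect_swap (U : GaugeField P j G) (x : Site P j) (μ ν : Fin P.d) (a b : ℕ) :
    rect U x μ ν a b = (rect U x ν μ b a)⁻¹ := by
  unfold rect
  group

/-- **Non-abelian Stokes, orientation-free**: for `μ ≠ ν`, `dist1 U(∂R_{a,b}) ≤ Σ_{t<b} Σ_{s<a} dist1 U(∂p_{s,t})` with the plaquette term at `x + s e_μ + t e_ν` written as the `1 × 1`
rectangle holonomy `rect U · μ ν 1 1` (for `ν < μ` this is the inverse plaquette variable, same `dist1`). [cite: Balaban1985Averaging, (19) p.21] -/
theorem dist1_rect_le_unoriented (U : GaugeField P j G) (x : Site P j) {μ ν : Fin P.d} (hμν : μ ≠ ν) (a b : ℕ) :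
    dist1 (rect U x μ ν a b) ≤
      ∑ t ∈ range b, ∑ s ∈ range a, dist1 (rect U (shiftN (shiftN x ν t) μ s) μ ν 1 1) := by
  rcases lt_or_gt_of_ne hμν with h | h
  · refine (dist1_rect_le U x h a b).trans (le_of_eq (Finset.sum_congr rfl fun t _ => Finset.sum_congr rfl fun s _ => ?_))
    rw [rect_one_one U _ h]
  · rw [rect_swap, GaugeGroup.dist1_inv]
    refine (dist1_rect_le U x h b a).trans (le_of_eq ?_)
    rw [Finset.sum_comm]
    refine Finset.sum_congr rfl fun t _ => Finset.sum_congr rfl fun s _ => ?_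
    rw [rect_swap U _ μ ν 1 1, GaugeGroup.dist1_inv, rect_one_one U _ h, shiftN_comm]

/-- ★ **Non-abelian Stokes in squares** (Cauchy–Schwarz over the `a·b` plaquettes): `dist1(U(∂R_{a,b}))² ≤ a·b·Σ_{t<b} Σ_{s<a} dist1(U(∂p_{s,t}))²`. [cite: Balaban1985Averaging, (19) p.21] -/
theorem dist1_rect_sq_le (U : GaugeField P j G) (x : Site P j) {μ ν : Fin P.d} (hμν : μ ≠ ν) (a b : ℕ) :
    dist1 (rect U x μ ν a b) ^ 2 ≤
      ((a * b : ℕ) : ℝ) * ∑ t ∈ range b, ∑ s ∈ range a, dist1 (rect U (shiftN (shiftN x ν t) μ s) μ ν 1 1) ^ 2 := by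
  refine (pow_le_pow_left₀ (GaugeGroup.dist1_nonneg _) (dist1_rect_le_unoriented U x hμν a b) 2).trans ?_
  -- Cauchy–Schwarz twice
  have hcs1 : (∑ t ∈ range b, ∑ s ∈ range a, dist1 (rect U (shiftN (shiftN x ν t) μ s) μ ν 1 1)) ^ 2 ≤
      (#(range b) : ℝ) * ∑ t ∈ range b, (∑ s ∈ range a, dist1 (rect U (shiftN (shiftN x ν t) μ s) μ ν 1 1)) ^ 2 :=
    sq_sum_le_card_mul_sum_sq
  have hcs2 : ∀ t, (∑ s ∈ range a, dist1 (rect U (shiftN (shiftN x ν t) μ s) μ ν 1 1)) ^ 2 ≤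
      (#(range a) : ℝ) * ∑ s ∈ range a, dist1 (rect U (shiftN (shiftN x ν t) μ s) μ ν 1 1) ^ 2 := fun t =>
    sq_sum_le_card_mul_sum_sq
  rw [Finset.card_range] at hcs1
  simp only [Finset.card_range] at hcs2
  calc _ ≤ (b : ℝ) * ∑ t ∈ range b, (∑ s ∈ range a, dist1 (rect U (shiftN (shiftN x ν t) μ s) μ ν 1 1)) ^ 2 := hcs1
    _ ≤ (b : ℝ) * ∑ t ∈ range b, ((a : ℝ) * ∑ s ∈ range a, dist1 (rect U (shiftN (shiftN x ν t) μ s) μ ν 1 1) ^ 2) :=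
        mul_le_mul_of_nonneg_left (Finset.sum_le_sum fun t _ => hcs2 t) (Nat.cast_nonneg _)
    _ = _ := by rw [← Finset.mul_sum, ← mul_assoc, Nat.cast_mul, mul_comm (b : ℝ)]

/-! ## §2 One transverse direction: all pairs of rows, and the weight of a plaquette row is at most `N·a` per pair -/

/-- The per-pair bound read on the full strip: for `m + b ≤ a`, `dist1(U(∂R))²` of the `N × b` rectangle at `x₀ + m e_ν` is at most `N·a` times the FULL strip sum
`Σ_{t<a} Σ_{s<N} dist1(U(∂p_{s,t}))²` (Stokes in squares, `b ≤ a`, and the rectangle's plaquette rows `m ≤ t < m + b` are among the strip's). [cite: Balaban1985Averaging, (19) p.21] -/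
theorem dist1_rect_sq_le_strip (U : GaugeField P j G) (x₀ : Site P j) {μ ν : Fin P.d} (hμν : μ ≠ ν) (N a m b : ℕ) (hmb : m + b ≤ a) :
    dist1 (rect U (shiftN x₀ ν m) μ ν N b) ^ 2 ≤
      (N : ℝ) * (a : ℝ) * ∑ t ∈ range a, ∑ s ∈ range N, dist1 (rect U (shiftN (shiftN x₀ ν t) μ s) μ ν 1 1) ^ 2 := by
  have hq0 : ∀ t, 0 ≤ ∑ s ∈ range N, dist1 (rect U (shiftN (shiftN x₀ ν t) μ s) μ ν 1 1) ^ 2 := fun t =>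
    Finset.sum_nonneg fun _ _ => sq_nonneg _
  have h1 := dist1_rect_sq_le U (shiftN x₀ ν m) hμν N b
  simp only [shiftN_add] at h1
  -- the rectangle's rows are the strip's rows `m ≤ t < m + b`
  have h2 : ∑ t ∈ range b, ∑ s ∈ range N, dist1 (rect U (shiftN (shiftN x₀ ν (m + t)) μ s) μ ν 1 1) ^ 2 ≤
      ∑ t ∈ range a, ∑ s ∈ range N, dist1 (rect U (shiftN (shiftN x₀ ν t) μ s) μ ν 1 1) ^ 2 := by
    have e : ∑ t ∈ range b, ∑ s ∈ range N, dist1 (rect U (shiftN (shiftN x₀ ν (m + t)) μ s) μ ν 1 1) ^ 2 =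
        ∑ t ∈ Ico m (m + b), ∑ s ∈ range N, dist1 (rect U (shiftN (shiftN x₀ ν t) μ s) μ ν 1 1) ^ 2 := by
      rw [Finset.sum_Ico_eq_sum_range, Nat.add_sub_cancel_left]
    rw [e]
    exact Finset.sum_le_sum_of_subset_of_nonneg (fun t ht => by
      rw [Finset.mem_Ico] at ht; rw [Finset.mem_range]; omega) fun t _ _ => hq0 t
  have hb : (b : ℝ) ≤ a := by exact_mod_cast (show b ≤ a by omega)
  have hS0 := Finset.sum_nonneg fun t (_ : t ∈ range a) => hq0 t
  calc dist1 (rect U (shiftN x₀ ν m) μ ν N b) ^ 2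
      ≤ ((N * b : ℕ) : ℝ) * ∑ t ∈ range b, ∑ s ∈ range N, dist1 (rect U (shiftN (shiftN x₀ ν (m + t)) μ s) μ ν 1 1) ^ 2 := h1
    _ ≤ ((N * b : ℕ) : ℝ) * ∑ t ∈ range a, ∑ s ∈ range N, dist1 (rect U (shiftN (shiftN x₀ ν t) μ s) μ ν 1 1) ^ 2 :=
        mul_le_mul_of_nonneg_left h2 (Nat.cast_nonneg _)
    _ ≤ (N : ℝ) * (a : ℝ) * ∑ t ∈ range a, ∑ s ∈ range N, dist1 (rect U (shiftN (shiftN x₀ ν t) μ s) μ ν 1 1) ^ 2 := by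
        push_cast
        exact mul_le_mul_of_nonneg_right (mul_le_mul_of_nonneg_left hb (Nat.cast_nonneg _)) hS0

/-- ★★ **ALL PAIRS OF ROWS IN ONE TRANSVERSE DIRECTION**: the `a` straight rows of length `N` (direction `μ`) through `x₀ + i e_ν`, `i < a`; rows `i, i′` are compared by the rectangle
holonomy on `[min i i′, max i i′] × [0, N]` (the two rows and their `ν`-connectors at both ends), and
`Σ_{i,i′ < a} dist1(U(∂R_{i,i′}))² ≤ N·a³·Σ_{t<a} Σ_{s<N} dist1(U(∂p_{s,t}))²` — per pair `N·a` (NOT `N·a²`), times `a²` pairs. [cite: Balaban1985Averaging, (19) p.21; Balaban1985RegularSpaces, Lemma 1 p.79] -/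
theorem sum_pair_dist1_rect_sq_le (U : GaugeField P j G) (x₀ : Site P j) {μ ν : Fin P.d} (hμν : μ ≠ ν) (N a : ℕ) :
    ∑ i ∈ range a, ∑ i' ∈ range a, dist1 (rect U (shiftN x₀ ν (min i i')) μ ν N (max i i' - min i i')) ^ 2 ≤
      (N : ℝ) * (a : ℝ) ^ 3 * ∑ t ∈ range a, ∑ s ∈ range N, dist1 (rect U (shiftN (shiftN x₀ ν t) μ s) μ ν 1 1) ^ 2 := by
  have hpair : ∀ i ∈ range a, ∀ i' ∈ range a,
      dist1 (rect U (shiftN x₀ ν (min i i')) μ ν N (max i i' - min i i')) ^ 2 ≤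
        (N : ℝ) * (a : ℝ) * ∑ t ∈ range a, ∑ s ∈ range N, dist1 (rect U (shiftN (shiftN x₀ ν t) μ s) μ ν 1 1) ^ 2 := by
    intro i hi i' hi'
    rw [Finset.mem_range] at hi hi'
    refine dist1_rect_sq_le_strip U x₀ hμν N a _ _ ?_
    rcases le_total i i' with h | h
    · rw [min_eq_left h, max_eq_right h]; omega
    · rw [min_eq_right h, max_eq_left h]; omega
  calc ∑ i ∈ range a, ∑ i' ∈ range a, dist1 (rect U (shiftN x₀ ν (min i i')) μ ν N (max i i' - min i i')) ^ 2
      ≤ ∑ i ∈ range a, ∑ i' ∈ range a,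
          (N : ℝ) * (a : ℝ) * ∑ t ∈ range a, ∑ s ∈ range N, dist1 (rect U (shiftN (shiftN x₀ ν t) μ s) μ ν 1 1) ^ 2 :=
        Finset.sum_le_sum fun i hi => Finset.sum_le_sum fun i' hi' => hpair i hi i' hi'
    _ = (N : ℝ) * (a : ℝ) ^ 3 * ∑ t ∈ range a, ∑ s ∈ range N, dist1 (rect U (shiftN (shiftN x₀ ν t) μ s) μ ν 1 1) ^ 2 := by
        rw [Finset.sum_const, Finset.sum_const, Finset.card_range, nsmul_eq_mul, nsmul_eq_mul]; ring

/-! ## §3 Two transverse directions: the staircase comparison of two rows of an `a × a` face and its mean square -/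

/-- ★★ **THE FORWARD–FORWARD STAIRCASE**: rows of length `N` (direction `μ`) through the face points `y_{ik} = x₀ + i e_ν + k e_ρ` and `y_{i+di,k+dk}`, compared along the
staircase «`di` steps `e_ν`, then `dk` steps `e_ρ`» at both ends — `C = T_{ik}·Γ_far·T_{i+di,k+dk}⁻¹·Γ_near⁻¹` — satisfy `dist1 C ≤ dist1 U(∂R_ν) + dist1 U(∂R_ρ)` with `R_ν` the
`N × di` rectangle in the `ρ`-plane `k` and `R_ρ` the `N × dk` rectangle in the `ν`-column `i + di` (`C = U(∂R_ν)·[g U(∂R_ρ) g⁻¹]`, `g` the near `ν`-connector). [cite: Balaban1985Averaging, (9) p.19, (19) p.21] -/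
theorem dist1_rowCompareFF_le (U : GaugeField P j G) (x₀ : Site P j) (μ ν ρ : Fin P.d) (N i k di dk : ℕ) :
    dist1 (rowProd U (shiftN (shiftN x₀ ν i) ρ k) μ N *
        (rowProd U (shiftN (shiftN (shiftN x₀ ν i) ρ k) μ N) ν di * rowProd U (shiftN (shiftN (shiftN x₀ ν (i + di)) ρ k) μ N) ρ dk) *
        (rowProd U (shiftN (shiftN x₀ ν (i + di)) ρ (k + dk)) μ N)⁻¹ *
        (rowProd U (shiftN (shiftN x₀ ν i) ρ k) ν di * rowProd U (shiftN (shiftN x₀ ν (i + di)) ρ k) ρ dk)⁻¹) ≤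
      dist1 (rect U (shiftN (shiftN x₀ ν i) ρ k) μ ν N di) + dist1 (rect U (shiftN (shiftN x₀ ν (i + di)) ρ k) μ ρ N dk) := by
  have hy1 : shiftN (shiftN (shiftN x₀ ν i) ρ k) ν di = shiftN (shiftN x₀ ν (i + di)) ρ k := by
    rw [shiftN_comm (shiftN x₀ ν i) ν ρ di k, shiftN_add]
  have hy2 : shiftN (shiftN (shiftN x₀ ν (i + di)) ρ k) ρ dk = shiftN (shiftN x₀ ν (i + di)) ρ (k + dk) := shiftN_add _ ρ k dk
  have e : rowProd U (shiftN (shiftN x₀ ν i) ρ k) μ N *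
        (rowProd U (shiftN (shiftN (shiftN x₀ ν i) ρ k) μ N) ν di * rowProd U (shiftN (shiftN (shiftN x₀ ν (i + di)) ρ k) μ N) ρ dk) *
        (rowProd U (shiftN (shiftN x₀ ν (i + di)) ρ (k + dk)) μ N)⁻¹ *
        (rowProd U (shiftN (shiftN x₀ ν i) ρ k) ν di * rowProd U (shiftN (shiftN x₀ ν (i + di)) ρ k) ρ dk)⁻¹ =
      rect U (shiftN (shiftN x₀ ν i) ρ k) μ ν N di *
        (rowProd U (shiftN (shiftN x₀ ν i) ρ k) ν di * rect U (shiftN (shiftN x₀ ν (i + di)) ρ k) μ ρ N dk *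
          (rowProd U (shiftN (shiftN x₀ ν i) ρ k) ν di)⁻¹) := by
    unfold rect
    rw [hy1, hy2]
    group
  rw [e]
  calc _ ≤ dist1 (rect U (shiftN (shiftN x₀ ν i) ρ k) μ ν N di) +
        dist1 (rowProd U (shiftN (shiftN x₀ ν i) ρ k) ν di * rect U (shiftN (shiftN x₀ ν (i + di)) ρ k) μ ρ N dk *
          (rowProd U (shiftN (shiftN x₀ ν i) ρ k) ν di)⁻¹) := GaugeGroup.dist1_mul_le _ _
    _ = _ := by rw [GaugeGroup.dist1_conj]

/-- ★★ **THE FORWARD–BACKWARD STAIRCASE**: rows through `y_{i,k′+dk}` (upper left) and `y_{i+di,k′}` (lower right), compared along «`di` steps `e_ν`, then `dk` steps `−e_ρ`» at both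
ends — `C = T_{i,k′+dk}·(g_f h_f⁻¹)·T_{i+di,k′}⁻¹·(g h⁻¹)⁻¹` with `h`, `h_f` the UPWARD `ρ`-connectors — satisfy `dist1 C ≤ dist1 U(∂R_ν) + dist1 U(∂R_ρ)`, `R_ν` in the `ρ`-plane
`k′ + dk`, `R_ρ` the `N × dk` rectangle in the column `i + di` based at `y_{i+di,k′}` (`C = U(∂R_ν)·[(g h⁻¹) U(∂R_ρ)⁻¹ (g h⁻¹)⁻¹]`, `dist1` of an inverse). [cite: Balaban1985Averaging, (9) p.19, (19) p.21] -/
theorem dist1_rowCompareFB_le (U : GaugeField P j G) (x₀ : Site P j) (μ ν ρ : Fin P.d) (N i k' di dk : ℕ) :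
    dist1 (rowProd U (shiftN (shiftN x₀ ν i) ρ (k' + dk)) μ N *
        (rowProd U (shiftN (shiftN (shiftN x₀ ν i) ρ (k' + dk)) μ N) ν di *
          (rowProd U (shiftN (shiftN (shiftN x₀ ν (i + di)) ρ k') μ N) ρ dk)⁻¹) *
        (rowProd U (shiftN (shiftN x₀ ν (i + di)) ρ k') μ N)⁻¹ *
        (rowProd U (shiftN (shiftN x₀ ν i) ρ (k' + dk)) ν di * (rowProd U (shiftN (shiftN x₀ ν (i + di)) ρ k') ρ dk)⁻¹)⁻¹) ≤
      dist1 (rect U (shiftN (shiftN x₀ ν i) ρ (k' + dk)) μ ν N di) + dist1 (rect U (shiftN (shiftN x₀ ν (i + di)) ρ k') μ ρ N dk) := by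
  have hy1 : shiftN (shiftN (shiftN x₀ ν i) ρ (k' + dk)) ν di = shiftN (shiftN x₀ ν (i + di)) ρ (k' + dk) := by
    rw [shiftN_comm (shiftN x₀ ν i) ν ρ di (k' + dk), shiftN_add]
  have hy2 : shiftN (shiftN (shiftN x₀ ν (i + di)) ρ k') ρ dk = shiftN (shiftN x₀ ν (i + di)) ρ (k' + dk) := shiftN_add _ ρ k' dk
  have e : rowProd U (shiftN (shiftN x₀ ν i) ρ (k' + dk)) μ N *
        (rowProd U (shiftN (shiftN (shiftN x₀ ν i) ρ (k' + dk)) μ N) ν di *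
          (rowProd U (shiftN (shiftN (shiftN x₀ ν (i + di)) ρ k') μ N) ρ dk)⁻¹) *
        (rowProd U (shiftN (shiftN x₀ ν (i + di)) ρ k') μ N)⁻¹ *
        (rowProd U (shiftN (shiftN x₀ ν i) ρ (k' + dk)) ν di * (rowProd U (shiftN (shiftN x₀ ν (i + di)) ρ k') ρ dk)⁻¹)⁻¹ =
      rect U (shiftN (shiftN x₀ ν i) ρ (k' + dk)) μ ν N di *
        ((rowProd U (shiftN (shiftN x₀ ν i) ρ (k' + dk)) ν di * (rowProd U (shiftN (shiftN x₀ ν (i + di)) ρ k') ρ dk)⁻¹) *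
          (rect U (shiftN (shiftN x₀ ν (i + di)) ρ k') μ ρ N dk)⁻¹ *
          (rowProd U (shiftN (shiftN x₀ ν i) ρ (k' + dk)) ν di * (rowProd U (shiftN (shiftN x₀ ν (i + di)) ρ k') ρ dk)⁻¹)⁻¹) := by
    unfold rect
    rw [hy1, hy2]
    group
  rw [e]
  calc _ ≤ dist1 (rect U (shiftN (shiftN x₀ ν i) ρ (k' + dk)) μ ν N di) +
        dist1 ((rowProd U (shiftN (shiftN x₀ ν i) ρ (k' + dk)) ν di * (rowProd U (shiftN (shiftN x₀ ν (i + di)) ρ k') ρ dk)⁻¹) *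
          (rect U (shiftN (shiftN x₀ ν (i + di)) ρ k') μ ρ N dk)⁻¹ *
          (rowProd U (shiftN (shiftN x₀ ν i) ρ (k' + dk)) ν di * (rowProd U (shiftN (shiftN x₀ ν (i + di)) ρ k') ρ dk)⁻¹)⁻¹) :=
        GaugeGroup.dist1_mul_le _ _
    _ = _ := by rw [GaugeGroup.dist1_conj, GaugeGroup.dist1_inv]

/-! ### The mean square over a quadrant of pairs: bookkeeping -/

/-- `Σ_{d < a − k} Q(k + d) ≤ Σ_{c < a} Q(c)` for a non-negative `Q` (the rows `k ≤ c < a` are among all rows). [folklore] -/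
private theorem sum_range_sub_shift_le (Q : ℕ → ℝ) (hQ : ∀ c, 0 ≤ Q c) (a k : ℕ) :
    ∑ d ∈ range (a - k), Q (k + d) ≤ ∑ c ∈ range a, Q c := by
  rw [← Finset.sum_Ico_eq_sum_range]
  exact Finset.sum_le_sum_of_subset_of_nonneg (fun c hc => by rw [Finset.mem_Ico] at hc; rw [Finset.mem_range]; exact hc.2)
    fun c _ _ => hQ c

/-- `Σ_{d < a − k} c ≤ a·c` for `0 ≤ c`. [folklore] -/
private theorem sum_range_sub_const_le {c : ℝ} (hc : 0 ≤ c) (a k : ℕ) : ∑ _d ∈ range (a - k), c ≤ (a : ℝ) * c := by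
  rw [Finset.sum_const, Finset.card_range, nsmul_eq_mul]
  exact mul_le_mul_of_nonneg_right (by exact_mod_cast Nat.sub_le a k) hc

/-- **Quadrant bookkeeping, forward–forward shape**: if `g(i,k,di,dk) ≤ A·Q(k) + A·Q′(i+di)` on the quadrant `i + di ≤ a`, `k + dk ≤ a`, then
`Σ_{i<a} Σ_{k<a} Σ_{di<a−i} Σ_{dk<a−k} g ≤ A·a³·(Σ_{k<a} Q(k) + Σ_{c<a} Q′(c))` (each plane ∕ column is charged at most `a³` times — NO anchoring). [folklore] -/
theorem quadSum_le_of_plane_column {a : ℕ} {A : ℝ} (hA : 0 ≤ A) {Q Q' : ℕ → ℝ} (hQ : ∀ k, 0 ≤ Q k) (hQ' : ∀ c, 0 ≤ Q' c)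
    (g : ℕ → ℕ → ℕ → ℕ → ℝ) (hg : ∀ i k di dk, i + di ≤ a → k + dk ≤ a → g i k di dk ≤ A * Q k + A * Q' (i + di)) :
    ∑ i ∈ range a, ∑ k ∈ range a, ∑ di ∈ range (a - i), ∑ dk ∈ range (a - k), g i k di dk ≤
      A * (a : ℝ) ^ 3 * (∑ k ∈ range a, Q k + ∑ c ∈ range a, Q' c) := by
  have ha : (0 : ℝ) ≤ a := Nat.cast_nonneg a
  -- innermost: the `dk`-sum of a `dk`-independent bound
  have h1 : ∀ i ∈ range a, ∀ k ∈ range a, ∀ di ∈ range (a - i),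
      ∑ dk ∈ range (a - k), g i k di dk ≤ (a : ℝ) * A * Q k + (a : ℝ) * A * Q' (i + di) := by
    intro i hi k hk di hdi
    rw [Finset.mem_range] at hi hk hdi
    refine (Finset.sum_le_sum fun dk hdk => hg i k di dk (by omega) (by rw [Finset.mem_range] at hdk; omega)).trans ?_
    refine (sum_range_sub_const_le (by have := hQ k; have := hQ' (i + di); positivity) a k).trans (le_of_eq ?_)
    ring
  -- the `di`-sum
  have h2 : ∀ i ∈ range a, ∀ k ∈ range a,
      ∑ di ∈ range (a - i), ∑ dk ∈ range (a - k), g i k di dk ≤ (a : ℝ) * A * (a : ℝ) * Q k + (a : ℝ) * A * ∑ c ∈ range a, Q' c := by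
    intro i hi k hk
    refine (Finset.sum_le_sum fun di hdi => h1 i hi k hk di hdi).trans ?_
    rw [Finset.sum_add_distrib]
    refine add_le_add ?_ ?_
    · refine (sum_range_sub_const_le (c := (a : ℝ) * A * Q k) (by have := hQ k; positivity) a i).trans (le_of_eq ?_)
      ring
    · rw [← Finset.mul_sum]
      exact mul_le_mul_of_nonneg_left (sum_range_sub_shift_le Q' hQ' a i) (mul_nonneg ha hA)
  -- the `k`-sum and the `i`-sum
  have h3 : ∀ i ∈ range a, ∑ k ∈ range a, ∑ di ∈ range (a - i), ∑ dk ∈ range (a - k), g i k di dk ≤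
      (a : ℝ) * A * (a : ℝ) * ∑ k ∈ range a, Q k + (a : ℝ) * ((a : ℝ) * A * ∑ c ∈ range a, Q' c) := by
    intro i hi
    refine (Finset.sum_le_sum fun k hk => h2 i hi k hk).trans (le_of_eq ?_)
    rw [Finset.sum_add_distrib, Finset.sum_const, Finset.card_range, nsmul_eq_mul, ← Finset.mul_sum]
  refine (Finset.sum_le_sum fun i hi => h3 i hi).trans (le_of_eq ?_)
  rw [Finset.sum_const, Finset.card_range, nsmul_eq_mul]
  ring

/-- **Quadrant bookkeeping, forward–backward shape**: if `g(i,k′,di,dk) ≤ A·Q(k′+dk) + A·Q′(i+di)` on `i + di ≤ a`, `k′ + dk ≤ a`, then the same bound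
`Σ g ≤ A·a³·(Σ Q + Σ Q′)` holds. [folklore] -/
theorem quadSum_le_of_plane_column' {a : ℕ} {A : ℝ} (hA : 0 ≤ A) {Q Q' : ℕ → ℝ} (hQ : ∀ k, 0 ≤ Q k) (hQ' : ∀ c, 0 ≤ Q' c)
    (g : ℕ → ℕ → ℕ → ℕ → ℝ) (hg : ∀ i k di dk, i + di ≤ a → k + dk ≤ a → g i k di dk ≤ A * Q (k + dk) + A * Q' (i + di)) :
    ∑ i ∈ range a, ∑ k ∈ range a, ∑ di ∈ range (a - i), ∑ dk ∈ range (a - k), g i k di dk ≤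
      A * (a : ℝ) ^ 3 * (∑ k ∈ range a, Q k + ∑ c ∈ range a, Q' c) := by
  have ha : (0 : ℝ) ≤ a := Nat.cast_nonneg a
  have hF : 0 ≤ ∑ c ∈ range a, Q c := Finset.sum_nonneg fun c _ => hQ c
  have h1 : ∀ i ∈ range a, ∀ k ∈ range a, ∀ di ∈ range (a - i),
      ∑ dk ∈ range (a - k), g i k di dk ≤ A * ∑ c ∈ range a, Q c + (a : ℝ) * A * Q' (i + di) := by
    intro i hi k hk di hdi
    rw [Finset.mem_range] at hi hk hdi
    refine (Finset.sum_le_sum fun dk hdk => hg i k di dk (by omega) (by rw [Finset.mem_range] at hdk; omega)).trans ?_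
    rw [Finset.sum_add_distrib]
    refine add_le_add ?_ ?_
    · rw [← Finset.mul_sum]
      exact mul_le_mul_of_nonneg_left (sum_range_sub_shift_le Q hQ a k) hA
    · refine (sum_range_sub_const_le (c := A * Q' (i + di)) (by have := hQ' (i + di); positivity) a k).trans (le_of_eq ?_)
      ring
  have h2 : ∀ i ∈ range a, ∀ k ∈ range a,
      ∑ di ∈ range (a - i), ∑ dk ∈ range (a - k), g i k di dk ≤ (a : ℝ) * (A * ∑ c ∈ range a, Q c) + (a : ℝ) * A * ∑ c ∈ range a, Q' c := by
    intro i hi k hk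
    refine (Finset.sum_le_sum fun di hdi => h1 i hi k hk di hdi).trans ?_
    rw [Finset.sum_add_distrib]
    refine add_le_add (sum_range_sub_const_le (mul_nonneg hA hF) a i) ?_
    rw [← Finset.mul_sum]
    exact mul_le_mul_of_nonneg_left (sum_range_sub_shift_le Q' hQ' a i) (mul_nonneg ha hA)
  have h3 : ∀ i ∈ range a, ∑ k ∈ range a, ∑ di ∈ range (a - i), ∑ dk ∈ range (a - k), g i k di dk ≤
      (a : ℝ) * ((a : ℝ) * (A * ∑ c ∈ range a, Q c) + (a : ℝ) * A * ∑ c ∈ range a, Q' c) := by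
    intro i hi
    refine (Finset.sum_le_sum fun k hk => h2 i hi k hk).trans (le_of_eq ?_)
    rw [Finset.sum_const, Finset.card_range, nsmul_eq_mul]
  refine (Finset.sum_le_sum fun i hi => h3 i hi).trans (le_of_eq ?_)
  rw [Finset.sum_const, Finset.card_range, nsmul_eq_mul]
  ring

/-- `(d₁ + d₂)²`-bookkeeping: `0 ≤ c ≤ d₁ + d₂`, `d₁² ≤ B₁`, `d₂² ≤ B₂` ⟹ `c² ≤ 2B₁ + 2B₂`. [folklore] -/
private theorem sq_le_two_add {c d₁ d₂ B₁ B₂ : ℝ} (hc : 0 ≤ c) (h : c ≤ d₁ + d₂) (h₁ : d₁ ^ 2 ≤ B₁) (h₂ : d₂ ^ 2 ≤ B₂) :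
    c ^ 2 ≤ 2 * B₁ + 2 * B₂ := by
  have h3 : c ^ 2 ≤ (d₁ + d₂) ^ 2 := pow_le_pow_left₀ hc h 2
  nlinarith [sq_nonneg (d₁ - d₂)]

/-- ★★★ **THE MEAN SQUARE OF THE ROW COMPARISONS OVER THE FORWARD QUADRANT OF AN `a × a` FACE COSTS ONE POWER OF `N`**: rows of length `N` (direction `μ`) through the face points
`x₀ + i e_ν + k e_ρ`; over all pairs `(i,k) → (i+di, k+dk)` inside the face,
`Σ dist1(C_FF)² ≤ 2·N·a⁴·(F_{μν} + F_{μρ})`, `F_{μν} = Σ_{k<a} Σ_{t<a} Σ_{s<N} dist1(U(∂p))²` over the `(μ,ν)`-plaquettes of the slab `[0,N] × [0,a] × [0,a]` at `x₀` (plane by plane),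
`F_{μρ}` likewise — per pair (`≤ a⁴` of them) the slab action enters with weight `2N`, NOT `N·a`: the staircase ribbons of different pairs lie in different planes ∕ columns, no plane is charged
more than `a³` times (the elementary form of the «Bianchi» power of px20 g18 UV3-NODE §53 (3)).  Backward quadrants: the same letter read from the other endpoint (`dist1 (h C⁻¹ h⁻¹) = dist1 C`).
[cite: Balaban1985Averaging, (19) p.21; Balaban1985RegularSpaces, Lemma 1 p.79; Balaban1984PropagatorsII, (1.33)] -/
theorem sum_quad_dist1_rowCompareFF_sq_le (U : GaugeField P j G) (x₀ : Site P j) {μ ν ρ : Fin P.d} (hμν : μ ≠ ν) (hμρ : μ ≠ ρ) (N a : ℕ) :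
    ∑ i ∈ range a, ∑ k ∈ range a, ∑ di ∈ range (a - i), ∑ dk ∈ range (a - k),
      dist1 (rowProd U (shiftN (shiftN x₀ ν i) ρ k) μ N *
        (rowProd U (shiftN (shiftN (shiftN x₀ ν i) ρ k) μ N) ν di * rowProd U (shiftN (shiftN (shiftN x₀ ν (i + di)) ρ k) μ N) ρ dk) *
        (rowProd U (shiftN (shiftN x₀ ν (i + di)) ρ (k + dk)) μ N)⁻¹ *
        (rowProd U (shiftN (shiftN x₀ ν i) ρ k) ν di * rowProd U (shiftN (shiftN x₀ ν (i + di)) ρ k) ρ dk)⁻¹) ^ 2 ≤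
      2 * (N : ℝ) * (a : ℝ) ^ 4 *
        (∑ k ∈ range a, ∑ t ∈ range a, ∑ s ∈ range N, dist1 (rect U (shiftN (shiftN (shiftN x₀ ρ k) ν t) μ s) μ ν 1 1) ^ 2 +
          ∑ c ∈ range a, ∑ t ∈ range a, ∑ s ∈ range N, dist1 (rect U (shiftN (shiftN (shiftN x₀ ν c) ρ t) μ s) μ ρ 1 1) ^ 2) := by
  have hA : (0 : ℝ) ≤ 2 * (N : ℝ) * (a : ℝ) := by positivity
  have hQ : ∀ k, 0 ≤ ∑ t ∈ range a, ∑ s ∈ range N, dist1 (rect U (shiftN (shiftN (shiftN x₀ ρ k) ν t) μ s) μ ν 1 1) ^ 2 :=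
    fun k => Finset.sum_nonneg fun _ _ => Finset.sum_nonneg fun _ _ => sq_nonneg _
  have hQ' : ∀ c, 0 ≤ ∑ t ∈ range a, ∑ s ∈ range N, dist1 (rect U (shiftN (shiftN (shiftN x₀ ν c) ρ t) μ s) μ ρ 1 1) ^ 2 :=
    fun c => Finset.sum_nonneg fun _ _ => Finset.sum_nonneg fun _ _ => sq_nonneg _
  have h := quadSum_le_of_plane_column (a := a) hA hQ hQ'
    (fun i k di dk => dist1 (rowProd U (shiftN (shiftN x₀ ν i) ρ k) μ N *
        (rowProd U (shiftN (shiftN (shiftN x₀ ν i) ρ k) μ N) ν di * rowProd U (shiftN (shiftN (shiftN x₀ ν (i + di)) ρ k) μ N) ρ dk) *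
        (rowProd U (shiftN (shiftN x₀ ν (i + di)) ρ (k + dk)) μ N)⁻¹ *
        (rowProd U (shiftN (shiftN x₀ ν i) ρ k) ν di * rowProd U (shiftN (shiftN x₀ ν (i + di)) ρ k) ρ dk)⁻¹) ^ 2)
    (fun i k di dk hi hk => by
      have h1 : dist1 (rect U (shiftN (shiftN x₀ ν i) ρ k) μ ν N di) ^ 2 ≤
          (N : ℝ) * (a : ℝ) * ∑ t ∈ range a, ∑ s ∈ range N, dist1 (rect U (shiftN (shiftN (shiftN x₀ ρ k) ν t) μ s) μ ν 1 1) ^ 2 := by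
        rw [shiftN_comm x₀ ρ ν k i]
        exact dist1_rect_sq_le_strip U (shiftN x₀ ρ k) hμν N a i di hi
      have h2 : dist1 (rect U (shiftN (shiftN x₀ ν (i + di)) ρ k) μ ρ N dk) ^ 2 ≤
          (N : ℝ) * (a : ℝ) * ∑ t ∈ range a, ∑ s ∈ range N, dist1 (rect U (shiftN (shiftN (shiftN x₀ ν (i + di)) ρ t) μ s) μ ρ 1 1) ^ 2 :=
        dist1_rect_sq_le_strip U (shiftN x₀ ν (i + di)) hμρ N a k dk hk
      have h3 := sq_le_two_add (GaugeGroup.dist1_nonneg _) (dist1_rowCompareFF_le U x₀ μ ν ρ N i k di dk) h1 h2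
      refine h3.trans (le_of_eq ?_)
      ring)
  refine h.trans (le_of_eq ?_)
  ring

/-- ★★★ **THE SAME OVER THE FORWARD–BACKWARD QUADRANT** (pairs `(i, k′+dk) → (i+di, k′)`): `Σ dist1(C_FB)² ≤ 2·N·a⁴·(F_{μν} + F_{μρ})`. Together with
`sum_quad_dist1_rowCompareFF_sq_le` (and the two read from the other endpoint) this is the mean square over ALL pairs of face points: the transverse VARIANCE of the `N`-row transports over
an `a × a` face is `≤ 8·N·(F_{μν} + F_{μρ})` per pair. [cite: Balaban1985Averaging, (19) p.21; Balaban1985RegularSpaces, Lemma 1 p.79; Balaban1984PropagatorsII, (1.33)] -/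
theorem sum_quad_dist1_rowCompareFB_sq_le (U : GaugeField P j G) (x₀ : Site P j) {μ ν ρ : Fin P.d} (hμν : μ ≠ ν) (hμρ : μ ≠ ρ) (N a : ℕ) :
    ∑ i ∈ range a, ∑ k' ∈ range a, ∑ di ∈ range (a - i), ∑ dk ∈ range (a - k'),
      dist1 (rowProd U (shiftN (shiftN x₀ ν i) ρ (k' + dk)) μ N *
        (rowProd U (shiftN (shiftN (shiftN x₀ ν i) ρ (k' + dk)) μ N) ν di *
          (rowProd U (shiftN (shiftN (shiftN x₀ ν (i + di)) ρ k') μ N) ρ dk)⁻¹) *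
        (rowProd U (shiftN (shiftN x₀ ν (i + di)) ρ k') μ N)⁻¹ *
        (rowProd U (shiftN (shiftN x₀ ν i) ρ (k' + dk)) ν di * (rowProd U (shiftN (shiftN x₀ ν (i + di)) ρ k') ρ dk)⁻¹)⁻¹) ^ 2 ≤
      2 * (N : ℝ) * (a : ℝ) ^ 4 *
        (∑ k ∈ range a, ∑ t ∈ range a, ∑ s ∈ range N, dist1 (rect U (shiftN (shiftN (shiftN x₀ ρ k) ν t) μ s) μ ν 1 1) ^ 2 +
          ∑ c ∈ range a, ∑ t ∈ range a, ∑ s ∈ range N, dist1 (rect U (shiftN (shiftN (shiftN x₀ ν c) ρ t) μ s) μ ρ 1 1) ^ 2) := by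
  have hA : (0 : ℝ) ≤ 2 * (N : ℝ) * (a : ℝ) := by positivity
  have hQ : ∀ k, 0 ≤ ∑ t ∈ range a, ∑ s ∈ range N, dist1 (rect U (shiftN (shiftN (shiftN x₀ ρ k) ν t) μ s) μ ν 1 1) ^ 2 :=
    fun k => Finset.sum_nonneg fun _ _ => Finset.sum_nonneg fun _ _ => sq_nonneg _
  have hQ' : ∀ c, 0 ≤ ∑ t ∈ range a, ∑ s ∈ range N, dist1 (rect U (shiftN (shiftN (shiftN x₀ ν c) ρ t) μ s) μ ρ 1 1) ^ 2 :=
    fun c => Finset.sum_nonneg fun _ _ => Finset.sum_nonneg fun _ _ => sq_nonneg _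
  have h := quadSum_le_of_plane_column' (a := a) hA hQ hQ'
    (fun i k' di dk => dist1 (rowProd U (shiftN (shiftN x₀ ν i) ρ (k' + dk)) μ N *
        (rowProd U (shiftN (shiftN (shiftN x₀ ν i) ρ (k' + dk)) μ N) ν di *
          (rowProd U (shiftN (shiftN (shiftN x₀ ν (i + di)) ρ k') μ N) ρ dk)⁻¹) *
        (rowProd U (shiftN (shiftN x₀ ν (i + di)) ρ k') μ N)⁻¹ *
        (rowProd U (shiftN (shiftN x₀ ν i) ρ (k' + dk)) ν di * (rowProd U (shiftN (shiftN x₀ ν (i + di)) ρ k') ρ dk)⁻¹)⁻¹) ^ 2)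
    (fun i k' di dk hi hk => by
      have h1 : dist1 (rect U (shiftN (shiftN x₀ ν i) ρ (k' + dk)) μ ν N di) ^ 2 ≤
          (N : ℝ) * (a : ℝ) * ∑ t ∈ range a, ∑ s ∈ range N, dist1 (rect U (shiftN (shiftN (shiftN x₀ ρ (k' + dk)) ν t) μ s) μ ν 1 1) ^ 2 := by
        rw [shiftN_comm x₀ ρ ν (k' + dk) i]
        exact dist1_rect_sq_le_strip U (shiftN x₀ ρ (k' + dk)) hμν N a i di hi
      have h2 : dist1 (rect U (shiftN (shiftN x₀ ν (i + di)) ρ k') μ ρ N dk) ^ 2 ≤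
          (N : ℝ) * (a : ℝ) * ∑ t ∈ range a, ∑ s ∈ range N, dist1 (rect U (shiftN (shiftN (shiftN x₀ ν (i + di)) ρ t) μ s) μ ρ 1 1) ^ 2 :=
        dist1_rect_sq_le_strip U (shiftN x₀ ν (i + di)) hμρ N a k' dk hk
      have h3 := sq_le_two_add (GaugeGroup.dist1_nonneg _) (dist1_rowCompareFB_le U x₀ μ ν ρ N i k' di dk) h1 h2
      refine h3.trans (le_of_eq ?_)
      ring)
  refine h.trans (le_of_eq ?_)
  ring

end Summit.QuantumFields.YangMills.Theorems.FluctuationComparisonRegPrIntLS2BetaRowTransportVariance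

end
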